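import Literature.Algebra.Homology.DiscreteRepLayerColimitDesc
import Literature.Algebra.Homology.DiscreteRepTrivialDuality
import Literature.Algebra.Homology.IntModBockstein
import Literature.Algebra.Homology.RepExtGroupCohomologyNaturality
import Literature.Algebra.Homology.ExtDualityModM
import HarnessLib

/-!
# Milne's hypothesis (b) `α¹(Δ, ℤ/m)` READ ON THE LAYERS of `(d)`: the pairing
# `(c, y) ↦ inv ((y ∘ [0 → ℤ → ℤ → ℤ/m → 0]) ∘ c)` is `inv (Inf_V (β_m χ ∪ c))`, `β_m` the mod-`m` Bockstein
# (Milne ADT I Lemma 1.7 / Theorem 1.8 (b); Serre, *Galois Cohomology* I §2.2 Prop. 8)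

Topic `Algebra/Homology`; namespace `Literature.Algebra.Homology.DiscreteRep` (layer statements in
`DiscreteRep.LayerColimit`).  Definitions with bodies (`zmodSC`, the short complex `0 → ℤ —m→ ℤ → ℤ/m → 0` of
`C_Δ`; `infTrivIso`, `layerToZmodSC`, the comparison of its layer at an open normal `V` (door-c6's
`Bockstein.intModShortComplex (Δ ⧸ V) m`) with it; `inflTriv`, inflation of `Ext` classes between trivial modules)
and theorems; no named fact, no instance, no `sorry`.  Sequel of `DiscreteRepLayerColimitGroupCohomology` ((d) in
`groupCohomology` currency), `DiscreteRepTrivialDuality` (`zmod_shortExact`), door-c6 g14's `IntModBockstein`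
(the Bockstein as Mathlib's `groupCohomology.δ`), `RepExtGroupCohomologyNaturality` / `…Delta` (the dictionary `E`
commutes with `Hⁿ(id, f)` and with `δ`), `ExtDualityModM` (door-c4 g15: `α¹(X₃)` ⟺ the pairing
`(c, y) ↦ inv ((y ∘ [S]) ∘ c)`).

THE POINT.  The last class-formation hypothesis of door-c4's Tate duality theorem
(`TateDualityHypotheses.adjointBijective_one_zmod`) is Milne's (b): `α¹(U, ℤ/m) : Ext¹_{C_U}(ℤ/m, C) → Ext¹_{C_U}(ℤ, ℤ/m)^*`
bijective for every open normal `U`.  By `ExtDualityModM` (with `Ext¹_U(ℤ, C) = 0`) this is a statement about the values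
`inv ((y ∘ [S_m]) ∘ c)` for `c ∈ Ext⁰(ℤ, C) = C^Δ` and `y ∈ Ext¹(ℤ, ℤ/m) = H¹(Δ, ℤ/m)`.  Here (for any topological group
`Δ`, `C ∈ C_Δ`, `m ≥ 1`):

* every `c ∈ Ext⁰_{C_Δ}(ℤ, C)` is `mk₀ φ` for a morphism `φ : ℤ → C` (an invariant vector), and every
  `y ∈ Ext¹_{C_Δ}(ℤ, ℤ/m)` is the inflation `inflTriv V y₁` of a class `y₁ ∈ Ext¹_{Rep ℤ (Δ⧸V)}(ℤ, ℤ/m) = H¹(Δ⧸V, ℤ/m) =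
  Hom(Δ⧸V, ℤ/m)` for some open normal `V` (`Δ` profinite; (d));
* **`comp_extClass_comp_mk₀_eq_inflG`**: `(inflTriv V y₁ ∘ [S_m]) ∘ mk₀ φ = Inf_V (H²(id, φ_V) (β_m (E y₁)))` — the class
  paired is the inflation from the layer `Δ⧸V` of the Bockstein `β_m χ ∈ H²(Δ⧸V, ℤ)` of the character `χ = E y₁` pushed to
  `H²(Δ⧸V, C^V)` along `φ_V : ℤ → C^V` (`LayerColimit.homToLayer`), i.e. the cup product `β_m χ ∪ c` of the texts;
* hence, for `inv` given on the layers by a compatible family `f` (`LayerColimit.desc`, door-c4 g16), the pairing value is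
  `f_i (Inf_{V→V_i} (H²(id, φ_V) (β_m χ)))` (`desc_layerPairingValue`), and the injectivity / surjectivity of `α¹(Δ, ℤ/m)` reduce
  to statements about these layer values (`adjointInjective_triv_zmod_of_layers`, `adjointSurjective_triv_zmod_of_layers`).

For the idèle class formation `(U, Res_U C̄)` the layer values are `inv_{H_E}(β_m χ ∪ x) = −χ(ψ_{E/L} x)/m`
(door-c6 g13/g14, Tate C–F VII §11.3), and the two statements are the kernel and the surjectivity of the Artin map
modulo `m`-th powers (door-c6 g11/g14) — the sequel.  Written for Route A of the Poitou–Tate programme of crux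
`stmt-BirchSwinnertonDyer-19295` (cell `bsd-schneider-ideate`, seat door-c4 gen 16).  HONEST FRAMING: homological
algebra only; no arithmetic statement and no case of BSD is proved here.

## References
* J. S. Milne, *Arithmetic Duality Theorems* (2nd ed. 2006), I §1 Lemma 1.7 (`α¹(G, ℤ/mℤ)` is induced by `rec_G`
  through `0 → ℤ → ℤ → ℤ/m → 0`), Theorem 1.8 (b). [MilneADT2006]
* J.-P. Serre, *Galois Cohomology* (1997), I §2.2 Proposition 8. [SerreGaloisCohomology1997]
* J. W. S. Cassels, A. Fröhlich (eds.), *Algebraic Number Theory* (1967), Ch. IV §6–7 (cup product with `δχ`),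
  Ch. VII §11.3. [CasselsFrohlichANT1967]
-/

noncomputable section

namespace Literature.Algebra.Homology

namespace DiscreteRep

open CategoryTheory CategoryTheory.Limits CategoryTheory.Abelian

variable {Δ : Type} [Group Δ] [TopologicalSpace Δ] [IsTopologicalGroup Δ]

/-! ## §1 `0 → ℤ —m→ ℤ → ℤ/m → 0` in `C_Δ` and its layers -/

/-- **The short complex `ℤ —m→ ℤ → ℤ/m` of `C_Δ`** (trivial actions; short exact for `m ≥ 1`, `zmod_shortExact`).
[cite: MilneADT2006, I Lemma 1.7] -/
abbrev zmodSC (m : ℕ) : ShortComplex (DiscreteRepCat ℤ Δ) :=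
  ShortComplex.mk (m • 𝟙 (triv (k := ℤ) (Γ := Δ) ℤ)) (trivIntCastHom (Δ := Δ) m) (nsmul_id_comp_trivIntCastHom m)

/-- `0 → ℤ —m→ ℤ → ℤ/m → 0` is short exact in `C_Δ` for `m ≥ 1` (door-c4 g15 `zmod_shortExact`).
[cite: MilneADT2006, I Lemma 1.7] -/
theorem zmodSC_shortExact (m : ℕ) (hm : 0 < m) : (zmodSC (Δ := Δ) m).ShortExact := zmod_shortExact m hm

variable {k : Type} [CommRing k] (V : Subgroup Δ) [V.Normal] (hV : IsOpen (V : Set Δ))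

/-- **The inflation of the trivial `Δ⧸V`-module `X` is the trivial `Δ`-module `X`** (definitionally; as an
isomorphism of `C_Δ`). [cite: SerreGaloisCohomology1997, I §2.2 Proposition 8] -/
def infTrivIso (X : Type) [AddCommGroup X] [Module k X] :
    (infFunctor k V hV).obj (Rep.trivial k (Δ ⧸ V) X) ≅ triv (k := k) (Γ := Δ) X :=
  Iso.refl _

/-- Formula: `infTrivIso` is the identity on vectors. [cite: SerreGaloisCohomology1997, I §2.2 Proposition 8] -/
@[simp]
theorem infTrivIso_hom_hom_hom_apply (X : Type) [AddCommGroup X] [Module k X] (x : X) :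
    (infTrivIso (k := k) V hV X).hom.hom.hom x = x := rfl

/-- **The comparison `Inf_V (0 → ℤ → ℤ → ℤ/m → 0 over Δ⧸V) ⟶ (0 → ℤ → ℤ → ℤ/m → 0 over Δ)`** (identity on
vectors): door-c6's `Bockstein.intModShortComplex (Δ ⧸ V) m`, inflated, maps to `zmodSC m`.
[cite: MilneADT2006, I Lemma 1.7][cite: SerreGaloisCohomology1997, I §2.2 Proposition 8] -/
def layerToZmodSC (m : ℕ) : (Bockstein.intModShortComplex (Δ ⧸ V) m).map (infFunctor ℤ V hV) ⟶ zmodSC (Δ := Δ) m where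
  τ₁ := (infTrivIso (k := ℤ) V hV ℤ).hom
  τ₂ := (infTrivIso (k := ℤ) V hV ℤ).hom
  τ₃ := (infTrivIso (k := ℤ) V hV (ZMod m)).hom
  comm₁₂ := by
    refine ObjectProperty.hom_ext _ (Rep.hom_ext (Representation.IntertwiningMap.ext (LinearMap.ext fun (x : ℤ) => ?_)))
    change (m • 𝟙 (triv (k := ℤ) (Γ := Δ) ℤ)).hom.hom x = Bockstein.intMulNat m x
    rw [nsmul_hom_hom_apply]
    show (m : ℤ) * x = x * (m : ℤ)
    exact mul_comm _ _
  comm₂₃ := by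
    refine ObjectProperty.hom_ext _ (Rep.hom_ext (Representation.IntertwiningMap.ext (LinearMap.ext fun x => ?_)))
    rfl

/-- `τ₁` of the comparison is the identity iso. [cite: SerreGaloisCohomology1997, I §2.2 Proposition 8] -/
theorem layerToZmodSC_τ₁ (m : ℕ) : (layerToZmodSC V hV m).τ₁ = (infTrivIso (k := ℤ) V hV ℤ).hom := rfl

/-- `τ₃` of the comparison is the identity iso. [cite: SerreGaloisCohomology1997, I §2.2 Proposition 8] -/
theorem layerToZmodSC_τ₃ (m : ℕ) : (layerToZmodSC V hV m).τ₃ = (infTrivIso (k := ℤ) V hV (ZMod m)).hom := rfl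

/-! ## §2 Inflation of classes between trivial modules; `Ext⁰` and `Ext¹(ℤ, ℤ/m)` in layer form -/

/-- **Inflation `Extⁿ_{Rep ℤ (Δ⧸V)}(X, Y) → Extⁿ_{C_Δ}(X, Y)` for trivial modules `X, Y`** (`Ext.mapExactFunctor` along
the exact inflation functor, then the identity isomorphism `Inf_V Y = Y`).
[cite: SerreGaloisCohomology1997, I §2.2 Proposition 8] -/
def inflTriv {X Y : Type} [AddCommGroup X] [Module k X] [AddCommGroup Y] [Module k Y] {n : ℕ}
    (y : Ext (Rep.trivial k (Δ ⧸ V) X) (Rep.trivial k (Δ ⧸ V) Y) n) :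
    Ext ((infFunctor k V hV).obj (Rep.trivial k (Δ ⧸ V) X)) (triv (k := k) (Γ := Δ) Y) n :=
  (y.mapExactFunctor (infFunctor k V hV)).comp (Ext.mk₀ (infTrivIso (k := k) V hV Y).hom) (add_zero n)

/-- Formula. [cite: SerreGaloisCohomology1997, I §2.2 Proposition 8] -/
theorem inflTriv_def {X Y : Type} [AddCommGroup X] [Module k X] [AddCommGroup Y] [Module k Y] {n : ℕ}
    (y : Ext (Rep.trivial k (Δ ⧸ V) X) (Rep.trivial k (Δ ⧸ V) Y) n) :
    inflTriv V hV y =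
      (y.mapExactFunctor (infFunctor k V hV)).comp (Ext.mk₀ (infTrivIso (k := k) V hV Y).hom) (add_zero n) :=
  rfl

/-- The identity-on-vectors morphism `(triv X)^V ⟶ X` of `Rep k (Δ⧸V)` from door-c4's layer object of a trivial module to
the trivial module (every vector of a trivial module is invariant). [cite: SerreGaloisCohomology1997, I §2.2 Proposition 8] -/
def trivLayerHom (X : Type) [AddCommGroup X] [Module k X] :
    (invariantsQuotFunctor k V).obj (triv (k := k) (Γ := Δ) X) ⟶ Rep.trivial k (Δ ⧸ V) X :=
  Rep.ofHom
    ⟨{ toFun := fun x => x.1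
       map_add' := fun _ _ => rfl
       map_smul' := fun _ _ => rfl },
     fun q => QuotientGroup.induction_on q fun _ => LinearMap.ext fun _ => rfl⟩

omit [IsTopologicalGroup Δ] in
/-- Formula. [cite: SerreGaloisCohomology1997, I §2.2 Proposition 8] -/
@[simp]
theorem trivLayerHom_hom_apply (X : Type) [AddCommGroup X] [Module k X]
    (x : ((triv (k := k) (Γ := Δ) X).obj.quotientToInvariants V).V) : (trivLayerHom (k := k) V X).hom x = x.1 := rfl

/-- `Inf(trivLayerHom) ≫ infTrivIso = invariantsIncl` (all maps are the identity on vectors).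
[cite: SerreGaloisCohomology1997, I §2.2 Proposition 8] -/
theorem infFunctor_map_trivLayerHom (X : Type) [AddCommGroup X] [Module k X] :
    (infFunctor k V hV).map (trivLayerHom (k := k) V X) ≫ (infTrivIso (k := k) V hV X).hom =
      invariantsIncl V hV (triv (k := k) (Γ := Δ) X) :=
  ObjectProperty.hom_ext _ (Rep.hom_ext (DFunLike.ext _ _ fun _ => rfl))

/-- **The inflation `extInf` of door-c4's system on a trivial module is `inflTriv` after `trivLayerHom`**:
`extInf_V (triv Y) n y = inflTriv V (y ∘ mk₀ trivLayerHom)`. [cite: SerreGaloisCohomology1997, I §2.2 Proposition 8] -/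
theorem extInf_triv_eq_inflTriv (Y : Type) [AddCommGroup Y] [Module k Y] {n : ℕ}
    (y : Ext (Rep.trivial k (Δ ⧸ V) k) ((invariantsQuotFunctor k V).obj (triv (k := k) (Γ := Δ) Y)) n) :
    extInf V hV (triv (k := k) (Γ := Δ) Y) n y =
      inflTriv V hV (y.comp (Ext.mk₀ (trivLayerHom (k := k) V Y)) (add_zero n)) := by
  rw [extInf_apply, inflTriv_def, Ext.mapExactFunctor_comp, Ext.mapExactFunctor_mk₀,
    Ext.comp_assoc_of_third_deg_zero, Ext.mk₀_comp_mk₀, infFunctor_map_trivLayerHom]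

namespace LayerColimit

/-- **Every class of `Extⁿ_{C_Δ}(k, Y)` (`Y` trivial, `Δ` profinite) is inflated from a layer class between trivial
modules**: for some open normal `V` and `y₁ ∈ Extⁿ_{Rep k (Δ⧸V)}(k, Y)`, `y = inflTriv V y₁` (from (d) `exists_inflG_eq` and
`trivLayerHom`). [cite: SerreGaloisCohomology1997, I §2.2 Proposition 8] -/
theorem exists_inflTriv_eq [CompactSpace Δ] [TotallyDisconnectedSpace Δ] (Y : Type) [AddCommGroup Y] [Module k Y]
    (n : ℕ) (y : Ext (triv (k := k) (Γ := Δ) k) (triv (k := k) (Γ := Δ) Y) n) :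
    ∃ (V : OpenNormalSubgroup Δ) (y₁ : Ext (Rep.trivial k (Δ ⧸ (V : Subgroup Δ)) k) (Rep.trivial k (Δ ⧸ (V : Subgroup Δ)) Y) n),
      inflTriv (V : Subgroup Δ) (coe_isOpen V) y₁ = y := by
  obtain ⟨V, c, rfl⟩ := exists_inflG_eq n (triv (k := k) (Γ := Δ) Y) y
  refine ⟨V, ((layerE V (triv (k := k) (Γ := Δ) Y) n).symm c).comp (Ext.mk₀ (trivLayerHom (k := k) (V : Subgroup Δ) Y))
    (add_zero n), ?_⟩
  rw [inflG_apply]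
  exact (extInf_triv_eq_inflTriv (V : Subgroup Δ) (coe_isOpen V) Y _).symm

end LayerColimit

/-- Every class of `Ext⁰(k, C)` is `mk₀` of a morphism `k → C` (an invariant vector of `C`).
[cite: MilneADT2006, I Lemma 1.7] -/
theorem exists_mk₀_eq {C : DiscreteRepCat k Δ} (c : Ext (triv (k := k) (Γ := Δ) k) C 0) :
    ∃ φ : triv (k := k) (Γ := Δ) k ⟶ C, Ext.mk₀ φ = c :=
  ⟨Ext.addEquiv₀ c, Ext.mk₀_addEquiv₀_apply c⟩

/-! ## §3 The class `(y ∘ [S_m]) ∘ c` read on the layer of `y` -/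

section Pairing

variable (C : DiscreteRepCat ℤ Δ) {m : ℕ} (hm : 0 < m)

/-- **`(inflTriv V y₁ ∘ [S_m]) ∘ mk₀ φ = extInf_V C ((y₁ ∘ [S_m^{Δ⧸V}]) ∘ mk₀ φ_V)`**: the class of `Ext²_{C_Δ}(ℤ, C)` paired
by Milne's `α¹(Δ, ℤ/m)` is inflated from the layer `Δ⧸V` — there it is the image under `φ_V : ℤ → C^V`
(`LayerColimit.homToLayer`) of `y₁ ∘ [0 → ℤ → ℤ → ℤ/m → 0]`, i.e. of the Bockstein of `y₁`.
[cite: MilneADT2006, I Lemma 1.7][cite: SerreGaloisCohomology1997, I §2.2 Proposition 8] -/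
theorem comp_extClass_comp_mk₀_eq_extInf (φ : triv (k := ℤ) (Γ := Δ) ℤ ⟶ C)
    (y₁ : Ext (Rep.trivial ℤ (Δ ⧸ V) ℤ) (Rep.trivial ℤ (Δ ⧸ V) (ZMod m)) 1) :
    haveI : NeZero m := ⟨hm.ne'⟩
    ((inflTriv V hV y₁).comp (zmodSC_shortExact (Δ := Δ) m hm).extClass (rfl : 1 + 1 = 2)).comp (Ext.mk₀ φ)
        (add_zero 2) =
      extInf V hV C 2 ((y₁.comp (Bockstein.intModShortComplex_shortExact (Δ ⧸ V) m).extClass (rfl : 1 + 1 = 2)).comp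
        (Ext.mk₀ (LayerColimit.homToLayer V C φ)) (add_zero 2)) := by
  haveI : NeZero m := ⟨hm.ne'⟩
  have key := mapExactFunctor_infFunctor_comp_extClass V hV (Bockstein.intModShortComplex_shortExact (Δ ⧸ V) m)
    (zmodSC_shortExact (Δ := Δ) m hm) (layerToZmodSC V hV m) y₁
  -- `τ₃`, `τ₁` of the comparison are the identity isomorphisms `infTrivIso`
  change ((inflTriv V hV y₁).comp (zmodSC_shortExact (Δ := Δ) m hm).extClass (rfl : 1 + 1 = 2)) =
    ((y₁.comp (Bockstein.intModShortComplex_shortExact (Δ ⧸ V) m).extClass (rfl : 1 + 1 = 2)).mapExactFunctor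
      (infFunctor ℤ V hV)).comp (Ext.mk₀ (infTrivIso (k := ℤ) V hV ℤ).hom) (add_zero 2) at key
  -- the right-hand side
  have hR : extInf V hV C 2 ((y₁.comp (Bockstein.intModShortComplex_shortExact (Δ ⧸ V) m).extClass
        (rfl : 1 + 1 = 2)).comp (Ext.mk₀ (LayerColimit.homToLayer V C φ)) (add_zero 2)) =
      ((y₁.comp (Bockstein.intModShortComplex_shortExact (Δ ⧸ V) m).extClass (rfl : 1 + 1 = 2)).mapExactFunctor
        (infFunctor ℤ V hV)).comp (Ext.mk₀ φ) (add_zero 2) := by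
    rw [extInf_apply, Ext.mapExactFunctor_comp, Ext.mapExactFunctor_mk₀, Ext.comp_assoc_of_third_deg_zero,
      Ext.mk₀_comp_mk₀]
    exact congrArg (fun ψ => ((y₁.comp (Bockstein.intModShortComplex_shortExact (Δ ⧸ V) m).extClass
      (rfl : 1 + 1 = 2)).mapExactFunctor (infFunctor ℤ V hV)).comp (Ext.mk₀ ψ) (add_zero 2))
      (LayerColimit.infFunctor_map_homToLayer_comp V hV C φ)
  -- the left-hand side
  rw [hR, key, Ext.comp_assoc_of_third_deg_zero, Ext.mk₀_comp_mk₀]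
  exact congrArg (fun ψ => ((y₁.comp (Bockstein.intModShortComplex_shortExact (Δ ⧸ V) m).extClass
    (rfl : 1 + 1 = 2)).mapExactFunctor (infFunctor ℤ V hV)).comp (Ext.mk₀ ψ) (add_zero 2)) (Category.id_comp φ)

/-- **The same in `groupCohomology` currency**: `(inflTriv V y₁ ∘ [S_m]) ∘ mk₀ φ =
Inf_V (H²(id, φ_V) (β_m (E y₁)))`, with `E : Ext¹_{Rep ℤ (Δ⧸V)}(ℤ, ℤ/m) ≃ H¹(Δ⧸V, ℤ/m)` door-c4's dictionary,
`β_m = groupCohomology.δ` of door-c6's `intModShortComplex` (the mod-`m` Bockstein) and `Inf_V = LayerColimit.inflG`.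
[cite: MilneADT2006, I Lemma 1.7][cite: CasselsFrohlichANT1967, Ch. IV §6–7] -/
theorem comp_extClass_comp_mk₀_eq_inflG (V : OpenNormalSubgroup Δ) (φ : triv (k := ℤ) (Γ := Δ) ℤ ⟶ C)
    (y₁ : Ext (Rep.trivial ℤ (Δ ⧸ (V : Subgroup Δ)) ℤ) (Rep.trivial ℤ (Δ ⧸ (V : Subgroup Δ)) (ZMod m)) 1) :
    haveI : NeZero m := ⟨hm.ne'⟩
    ((inflTriv (V : Subgroup Δ) (LayerColimit.coe_isOpen V) y₁).comp
        (zmodSC_shortExact (Δ := Δ) m hm).extClass (rfl : 1 + 1 = 2)).comp (Ext.mk₀ φ) (add_zero 2) =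
      LayerColimit.inflG V C 2
        (groupCohomology.map (MonoidHom.id _) (LayerColimit.homToLayer (V : Subgroup Δ) C φ) 2
          (groupCohomology.δ (Bockstein.intModShortComplex_shortExact (Δ ⧸ (V : Subgroup Δ)) m) 1 2 rfl
            (RepExt.extTrivialAddEquivGroupCohomology (Rep.trivial ℤ (Δ ⧸ (V : Subgroup Δ)) (ZMod m)) 1 y₁))) := by
  haveI : NeZero m := ⟨hm.ne'⟩
  have hδ : RepExt.extTrivialAddEquivGroupCohomology _ 2
      (y₁.comp (Bockstein.intModShortComplex_shortExact (Δ ⧸ (V : Subgroup Δ)) m).extClass (rfl : 1 + 1 = 2)) =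
      groupCohomology.δ (Bockstein.intModShortComplex_shortExact (Δ ⧸ (V : Subgroup Δ)) m) 1 2 rfl
        (RepExt.extTrivialAddEquivGroupCohomology (Rep.trivial ℤ (Δ ⧸ (V : Subgroup Δ)) (ZMod m)) 1 y₁) :=
    RepExt.extTrivialAddEquivGroupCohomology_comp_extClass'
      (Bockstein.intModShortComplex_shortExact (Δ ⧸ (V : Subgroup Δ)) m) 1 y₁
  rw [comp_extClass_comp_mk₀_eq_extInf (V : Subgroup Δ) (LayerColimit.coe_isOpen V) C hm φ y₁,
    LayerColimit.inflG_apply, RepExt.extTrivialAddEquivGroupCohomology_symm_naturality, ← hδ,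
    AddEquiv.symm_apply_apply]

end Pairing

/-! ## §4 Milne's (b) through the layer values -/

section Criteria

variable [CompactSpace Δ] [TotallyDisconnectedSpace Δ] (C : DiscreteRepCat ℤ Δ) {Q : Type} [AddCommGroup Q]
  (inv : Ext (triv (k := ℤ) (Γ := Δ) ℤ) C 2 →+ Q) {m : ℕ} (hm : 0 < m)
  (h1 : ∀ x : Ext (triv (k := ℤ) (Γ := Δ) ℤ) C 1, x = 0)

/-- The layer value of the pairing: `inv (Inf_V (H²(id, φ_V) (β_m χ)))` for `χ ∈ H¹(Δ⧸V, ℤ/m)` and `φ : ℤ → C`.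
[cite: MilneADT2006, I Lemma 1.7] -/
abbrev layerPairingValue (V : OpenNormalSubgroup Δ) (φ : triv (k := ℤ) (Γ := Δ) ℤ ⟶ C)
    (χ : groupCohomology (Rep.trivial ℤ (Δ ⧸ (V : Subgroup Δ)) (ZMod m)) 1) : Q :=
  haveI : NeZero m := ⟨hm.ne'⟩
  inv (LayerColimit.inflG V C 2
    (groupCohomology.map (MonoidHom.id _) (LayerColimit.homToLayer (V : Subgroup Δ) C φ) 2
      (groupCohomology.δ (Bockstein.intModShortComplex_shortExact (Δ ⧸ (V : Subgroup Δ)) m) 1 2 rfl χ)))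

omit [CompactSpace Δ] [TotallyDisconnectedSpace Δ] in
/-- **The pairing value on an inflated character**: `inv ((inflTriv V (E⁻¹ χ) ∘ [S_m]) ∘ mk₀ φ) = inv (Inf_V (H²(id, φ_V) (β_m χ)))`.
[cite: MilneADT2006, I Lemma 1.7] -/
theorem inv_comp_extClass_comp_mk₀ (V : OpenNormalSubgroup Δ) (φ : triv (k := ℤ) (Γ := Δ) ℤ ⟶ C)
    (χ : groupCohomology (Rep.trivial ℤ (Δ ⧸ (V : Subgroup Δ)) (ZMod m)) 1) :
    inv (((inflTriv (V : Subgroup Δ) (LayerColimit.coe_isOpen V)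
        ((RepExt.extTrivialAddEquivGroupCohomology (Rep.trivial ℤ (Δ ⧸ (V : Subgroup Δ)) (ZMod m)) 1).symm χ)).comp
        (zmodSC_shortExact (Δ := Δ) m hm).extClass (rfl : 1 + 1 = 2)).comp (Ext.mk₀ φ) (add_zero 2)) =
      layerPairingValue C inv hm V φ χ := by
  rw [comp_extClass_comp_mk₀_eq_inflG C hm V φ, AddEquiv.apply_symm_apply]

/-- **The layer value for an `inv` descended from a compatible family `f` of layer maps** (door-c4 g16
`LayerColimit.desc`): `inv (Inf_V (H²(id, φ_V) (β_m χ))) = f_i (Inf_{V → V_i} (H²(id, φ_V) (β_m χ)))` for any member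
`V_i ≤ V` of the family. [cite: MilneADT2006, I Lemma 1.7][cite: SerreGaloisCohomology1997, I §2.2 Proposition 8] -/
theorem desc_layerPairingValue {ι : Type} {W : ι → OpenNormalSubgroup Δ}
    {f : ∀ i, groupCohomology ((invariantsQuotFunctor ℤ (W i : Subgroup Δ)).obj C) 2 →+ Q}
    (hf : LayerColimit.IsCompatibleFamily W C 2 f) (V : OpenNormalSubgroup Δ) {i : ι} (hi : (W i : Subgroup Δ) ≤ V)
    (φ : triv (k := ℤ) (Γ := Δ) ℤ ⟶ C) (χ : groupCohomology (Rep.trivial ℤ (Δ ⧸ (V : Subgroup Δ)) (ZMod m)) 1) :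
    haveI : NeZero m := ⟨hm.ne'⟩
    layerPairingValue C (LayerColimit.desc W C 2 f hf) hm V φ χ =
      f i (LayerColimit.stepG V (W i) hi C 2
        (groupCohomology.map (MonoidHom.id _) (LayerColimit.homToLayer (V : Subgroup Δ) C φ) 2
          (groupCohomology.δ (Bockstein.intModShortComplex_shortExact (Δ ⧸ (V : Subgroup Δ)) m) 1 2 rfl χ))) :=
  LayerColimit.desc_inflG_of_le hf V hi _

omit [CompactSpace Δ] [TotallyDisconnectedSpace Δ] in
include h1 in
/-- **Milne's (b), injectivity, from the layers**: if an invariant vector `φ : ℤ → C` pairing to zero with EVERY layer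
character (`inv (Inf_V (H²(id, φ_V) (β_m χ))) = 0` for all open normal `V` and all `χ ∈ H¹(Δ⧸V, ℤ/m)`) is divisible by
`m` among the invariant vectors (`φ = m • φ₂`), then `α¹(Δ, ℤ/m)` is injective (given `Ext¹_Δ(ℤ, C) = 0`).
[cite: MilneADT2006, I Lemma 1.7, Theorem 1.8 (b)] -/
theorem adjointInjective_triv_zmod_of_layers
    (H : ∀ φ : triv (k := ℤ) (Γ := Δ) ℤ ⟶ C,
      (∀ (V : OpenNormalSubgroup Δ) (χ : groupCohomology (Rep.trivial ℤ (Δ ⧸ (V : Subgroup Δ)) (ZMod m)) 1),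
        layerPairingValue C inv hm V φ χ = 0) →
      ∃ φ₂ : triv (k := ℤ) (Γ := Δ) ℤ ⟶ C, m • φ₂ = φ) :
    ExtDuality.AdjointInjective inv (triv (k := ℤ) (Γ := Δ) (ZMod m)) (show 1 + 1 = 2 from rfl) := by
  haveI : NeZero m := ⟨hm.ne'⟩
  refine (ExtDuality.adjointInjective_X₃_iff inv (zmodSC_shortExact (Δ := Δ) m hm) h1).2 fun c hc => ?_
  obtain ⟨φ, rfl⟩ := exists_mk₀_eq c
  obtain ⟨φ₂, rfl⟩ := H φ fun V χ => by
    rw [← inv_comp_extClass_comp_mk₀ C inv hm V φ χ]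
    exact hc _
  refine ⟨Ext.mk₀ φ₂, ?_⟩
  change (Ext.mk₀ (m • 𝟙 (triv (k := ℤ) (Γ := Δ) ℤ))).comp (Ext.mk₀ φ₂) (zero_add 0) = Ext.mk₀ (m • φ₂)
  rw [Ext.mk₀_comp_mk₀, Preadditive.nsmul_comp, Category.id_comp]

include h1 in
/-- **Milne's (b), surjectivity, from the layers**: if every additive functional `Φ` on `Ext¹_{C_Δ}(ℤ, ℤ/m)` is
represented by an invariant vector `φ : ℤ → C` on the inflated layer characters
(`Φ (inflTriv V (E⁻¹ χ)) = inv (Inf_V (H²(id, φ_V) (β_m χ)))`), then `α¹(Δ, ℤ/m)` is surjective (given `Ext¹_Δ(ℤ, C) = 0`).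
[cite: MilneADT2006, I Lemma 1.7, Theorem 1.8 (b)] -/
theorem adjointSurjective_triv_zmod_of_layers
    (H : ∀ Φ : Ext (triv (k := ℤ) (Γ := Δ) ℤ) (triv (k := ℤ) (Γ := Δ) (ZMod m)) 1 →+ Q,
      ∃ φ : triv (k := ℤ) (Γ := Δ) ℤ ⟶ C,
        ∀ (V : OpenNormalSubgroup Δ) (χ : groupCohomology (Rep.trivial ℤ (Δ ⧸ (V : Subgroup Δ)) (ZMod m)) 1),
          Φ (inflTriv (V : Subgroup Δ) (LayerColimit.coe_isOpen V)
              ((RepExt.extTrivialAddEquivGroupCohomology (Rep.trivial ℤ (Δ ⧸ (V : Subgroup Δ)) (ZMod m)) 1).symm χ)) =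
            layerPairingValue C inv hm V φ χ) :
    ExtDuality.AdjointSurjective inv (triv (k := ℤ) (Γ := Δ) (ZMod m)) (show 1 + 1 = 2 from rfl) := by
  haveI : NeZero m := ⟨hm.ne'⟩
  refine (ExtDuality.adjointSurjective_X₃_iff inv (zmodSC_shortExact (Δ := Δ) m hm) h1).2 fun Φ => ?_
  obtain ⟨φ, hφ⟩ := H Φ
  refine ⟨Ext.mk₀ φ, fun y => ?_⟩
  obtain ⟨V, y₁, rfl⟩ := LayerColimit.exists_inflTriv_eq (k := ℤ) (ZMod m) 1 y
  have hy := hφ V (RepExt.extTrivialAddEquivGroupCohomology (Rep.trivial ℤ (Δ ⧸ (V : Subgroup Δ)) (ZMod m)) 1 y₁)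
  rw [AddEquiv.symm_apply_apply] at hy
  rw [hy, ← inv_comp_extClass_comp_mk₀ C inv hm V φ, AddEquiv.symm_apply_apply]
  rfl

include h1 in
/-- **Milne's (b) from the layers**: both criteria together give `α¹(Δ, ℤ/m)` bijective — the shape of the field
`TateDualityHypotheses.adjointBijective_one_zmod` (for the group `Δ = U` and the object `Res_U C`).
[cite: MilneADT2006, I Theorem 1.8 (b)] -/
theorem adjointBijective_triv_zmod_of_layers
    (Hinj : ∀ φ : triv (k := ℤ) (Γ := Δ) ℤ ⟶ C,
      (∀ (V : OpenNormalSubgroup Δ) (χ : groupCohomology (Rep.trivial ℤ (Δ ⧸ (V : Subgroup Δ)) (ZMod m)) 1),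
        layerPairingValue C inv hm V φ χ = 0) →
      ∃ φ₂ : triv (k := ℤ) (Γ := Δ) ℤ ⟶ C, m • φ₂ = φ)
    (Hsurj : ∀ Φ : Ext (triv (k := ℤ) (Γ := Δ) ℤ) (triv (k := ℤ) (Γ := Δ) (ZMod m)) 1 →+ Q,
      ∃ φ : triv (k := ℤ) (Γ := Δ) ℤ ⟶ C,
        ∀ (V : OpenNormalSubgroup Δ) (χ : groupCohomology (Rep.trivial ℤ (Δ ⧸ (V : Subgroup Δ)) (ZMod m)) 1),
          Φ (inflTriv (V : Subgroup Δ) (LayerColimit.coe_isOpen V)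
              ((RepExt.extTrivialAddEquivGroupCohomology (Rep.trivial ℤ (Δ ⧸ (V : Subgroup Δ)) (ZMod m)) 1).symm χ)) =
            layerPairingValue C inv hm V φ χ) :
    ExtDuality.AdjointBijective inv (triv (k := ℤ) (Γ := Δ) (ZMod m)) (show 1 + 1 = 2 from rfl) :=
  ⟨adjointInjective_triv_zmod_of_layers C inv hm h1 Hinj, adjointSurjective_triv_zmod_of_layers C inv hm h1 Hsurj⟩

end Criteria

end DiscreteRep

end Literature.Algebra.Homology

end
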